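import Mathlib
import Summits.ValiantsHypothesis.ValiantsHypothesis.Theses.GrenetZeon
import Summits.ValiantsHypothesis.ValiantsHypothesis.Theorems.GrenetZeonHessianRankCodimTwoPlaneCriterion

/-!
# Skeleton line `good_plane` for the crux `HessianRankCodimTwo` (stmt-ValiantsHypothesis-8061, route `GrenetZeon`)

**Idea (strengthen-to-certify).** The crux says: every hypersurface section `Z(per_n) ∩ Z(g) ≠ ∅`
contains a point where the `n² × n²` Hessian of `per_n` (the matrix of `(n−2)`-subpermanents) has rank
`> n²/2`.  The half-rank locus `B_n := {p ∈ Z(per_n) : rank Hess per_n(p) ≤ n²/2}` is Zariski closed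
(minors) and CONICAL (`per_n` is homogeneous, `Hess per_n(tp) = t^{n−2} Hess per_n(p)`).  By the
projective dimension theorem, `B_n` contains no conical subvariety of dimension `≥ n² − 2` as soon as it
misses a single 3-dimensional linear subspace `W` (a projective plane); and if a section
`Y = Z(per_n) ∩ Z(g)` (pure dimension `≥ n² − 2`, Krull) lay inside `B_n`, the closed cone over a
component of `Y` would be such a subvariety.  So the crux at `n` follows from the existence of ONE
GOOD PLANE `W`: `per_n(w) = 0, w ∈ W ∖ 0 ⇒ rank Hess per_n(w) > n²/2` — a statement about a plane curve
of degree `n` and finitely many minors, certifiable for each fixed `n` (resultants), and attackable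
uniformly through structured pencils (`aJ + `diagonal/permutation pencils, where `per_n` and its
subpermanents have closed forms), avoiding the Frobenius–König (zero-row) locus where the rank drops to
`≤ 2n`.

Stub 1 is known mathematics (dimension theory) and is PROVED in
`Theorems/GrenetZeonHessianRankCodimTwoPlaneCriterion.lean` (val-width-8061-p1, 2026-08-27; this file now
has one `sorry`, Stub 2); Stub 2 is the content (OPEN; evidence: refuter
certificates n = 3..6 report corank exactly 1 generically on the Hessian divisor, which gives
`dim B_n ≤ n² − 3` and hence good planes for those `n`).  VP ≠ VNP is not moved: the crux feeds only the
constant-factor two-parameter bound `TwoDimCoefficients`.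
-/

noncomputable section

set_option linter.dupNamespace false

namespace Summit.ValiantsHypothesis.ValiantsHypothesis.Cruxes.HessianRankCodimTwo.GoodPlane

open Literature.Computability.AlgebraicComplexity
open Summit.ValiantsHypothesis.ValiantsHypothesis.Theses.GrenetZeon

/-- The Hessian-rank condition of the crux at a point `p`. [folklore] -/
def HalfRankExceeded (n : ℕ) (p : Fin n × Fin n → ℂ) : Prop :=
  n ^ 2 < 2 * (hess0 (transl p (perPoly (Fin n) ℂ))).rank

/-- A GOOD PLANE for `per_n`: three linearly independent matrices such that at every non-zero point of
their span lying on the permanental hypersurface the Hessian of `per_n` has rank `> n²/2`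
(i.e. the projective plane `ℙ(W)` misses the half-rank locus `B_n`). [folklore] -/
def GoodPlane (n : ℕ) : Prop :=
  ∃ w : Fin 3 → (Fin n × Fin n → ℂ), LinearIndependent ℂ w ∧
    ∀ a : Fin 3 → ℂ, a ≠ 0 → MvPolynomial.eval (∑ i, a i • w i) (perPoly (Fin n) ℂ) = 0 →
      HalfRankExceeded n (∑ i, a i • w i)

/-! ### Registered stubs -/

/-- **Stub 1 (plane criterion; TRUE — dimension theory, size L in Lean).** If a good plane exists,
every non-empty hypersurface section of `Z(per_n)` meets the complement of the half-rank locus `B_n`.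
Proof: `B_n` is closed (vanishing of the `(⌊n²/2⌋+1)`-minors of `hess0 ∘ transl`, polynomial in `p`) and
conical; a component `Y₀` of `Z(per_n) ∩ Z(g)` has dimension `≥ n² − 2` (Krull's height theorem in
`ℂ[x]`, `n²` variables, two equations); if `Y₀ ⊆ B_n` then the closed cone `C(Y₀) ⊆ B_n` has dimension
`≥ n² − 2`, so `ℙ(C(Y₀))` (dimension `≥ n² − 3`) meets the projective plane `ℙ(W)` in `ℙ^{n²−1}`
(projective dimension theorem), producing `w ∈ W ∖ 0` in `B_n` — contradiction.  No hypothesis on `n`.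
Why it might fail: it does not (standard); the cost is formal (Mathlib has `ringKrullDim`,
`Ideal.height_le_spanRank`-type Krull, Noether normalisation; the projective intersection step may need
`Literature/AlgebraicGeometry/Dimension`).
**PROVED** (val-width-8061-p1, 2026-08-27): `Theorems/GrenetZeonHessianRankCodimTwoPlaneCriterion.lean`,
`…Theorems.GrenetZeon.HessianRankCodimTwo.planeCriterion` (the registered signature with `GoodPlane` /
`HalfRankExceeded` unfolded — definitionally this statement; general engine
`exists_common_zero_not_subset_cone`: homogeneous `T`, a `c`-plane missing `Z(T) ∖ 0`, fewer than `c`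
equations). [folklore] -/
theorem stub_planeCriterion :
    ∀ n : ℕ, GoodPlane n → ∀ g : MvPolynomial (Fin n × Fin n) ℂ,
      (∃ p : Fin n × Fin n → ℂ, MvPolynomial.eval p (perPoly (Fin n) ℂ) = 0 ∧ MvPolynomial.eval p g = 0) →
      ∃ p : Fin n × Fin n → ℂ, MvPolynomial.eval p (perPoly (Fin n) ℂ) = 0 ∧ MvPolynomial.eval p g = 0 ∧
        HalfRankExceeded n p :=
  fun n h g hg =>
    Summit.ValiantsHypothesis.ValiantsHypothesis.Theorems.GrenetZeon.HessianRankCodimTwo.planeCriterion n h g hg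

/-- **Stub 2 (good planes exist for all large `n`; OPEN — the content, size L).** Equivalent to
`dim B_n ≤ n² − 3` (a generic plane is then good), slightly stronger than the crux.  Attack: an explicit
structured pencil `W_n` on which `per_n` and its `(n−2)`-subpermanents have closed forms (e.g.
`span(J, D₁, D₂)` fails — it contains zero-row matrices, rank `≤ 2n` — so the pencil must avoid the
Frobenius–König locus, e.g. `span(J, P, P²)` with `P` the `n`-cycle, circulant permanents), and a fixed
`(⌊n²/2⌋+1)`-minor of the Hessian shown non-zero along the degree-`n` plane curve `per_n|_W = 0`.
Why it might fail: a prime divisor of `Z(per_n)` along which `≥ n²/2` independent subpermanent relations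
hold (none known; refuter certificates n = 3..6: generic corank 1 on every component of the Hessian
divisor), or a badly chosen explicit pencil hitting `B_n` although generic ones do not.
[cite: MignonRessayre2004, Thm. 1.1] -/
theorem stub_goodPlanes : ∃ n₀ : ℕ, ∀ n ≥ n₀, GoodPlane n := by
  sorry

/-! ### Composition (kernel-checked) -/

/-- **`HessianRankCodimTwo` from the two registered stubs.** [folklore] -/
theorem HessianRankCodimTwo_of : HessianRankCodimTwo := by
  obtain ⟨n₀, hgood⟩ := stub_goodPlanes
  exact ⟨n₀, fun n hn g hg => stub_planeCriterion n (hgood n hn) g hg⟩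

end Summit.ValiantsHypothesis.ValiantsHypothesis.Cruxes.HessianRankCodimTwo.GoodPlane
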